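import Summits.NavierStokesRegularity.FunctionalMining.NoGo.MiddleEigenvalueKillAllField
import Mathlib.Analysis.SpecialFunctions.SmoothTransition
import Mathlib.Analysis.SpecialFunctions.Sqrt
import HarnessLib

/-!
# K1-Q2 all-`q` kill-all, part 1: radial profiles of the SPIRAL jet

Search for candidate a priori estimates; no regularity claim. NS FUNCTIONAL MINING — NO-GO BRANCH
(cell `pub-nsfunc`, prove seat gen 13). The no-go seat's all-`q` kill-all N11(k) (for EVERY real
`q > 2` and every `C`, `MiddleEigenvalueMomentRateBound q C` fails; kernel instances `q = 4, 6` in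
`NoGo/MiddleEigenvalueKillAll{Witness,Six}`) is a paper theorem with two nested asymptotics
(jet aspect ratio `w → 0`, amplitude `ε → 0`). This chain replaces the Cartesian jet `A(x)A(2y)e_z` of
the tree's witness by a SPIRAL jet `j = k(s)(x cos ψ(s) − y sin ψ(s))` (`s = x² + y²`,
`k = B(s)/√s` with a plateau bump `B`, twist `ψ = π·smoothTransition(16s − ½)` supported on the
plateau), for which the `z`-symmetrised weighted stretching `[(|ω|²(z))^r − (|ω|²(1−z))^r]σ` is
POINTWISE `≥ 0` on the twist region and exactly ODD in `x` on the collars — so `∫(|ω|²)^rσ > 0`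
for every real `r > 0` with no smallness anywhere (prove seat note `FOR-NOGO.md`, 2026-08-21).

This file: the one-variable profiles and their support / sign / flatness facts —
`Bf` (Mathlib `ContDiffBump` centred at `1/16`, radii `1/32 < 7/128`: `Bf = 1` on `|s − 1/16| ≤ 1/32`,
`Bf = 0` off `|s − 1/16| < 7/128`), `kf s = Bf s · (√s)⁻¹` (smooth on `ℝ`: it vanishes for `s < 1/128`),
the twist `ψf` (`= 0` for `s ≤ 1/32`, `= π` for `s ≥ 3/32`, non-decreasing), `cf = cos ∘ ψf`,
`df = sin ∘ ψf`, the collar/plateau dichotomy `deriv Bf s = 0 ∨ (df s = 0 ∧ deriv ψf s = 0 ∧ cf s ^ 2 = 1)`,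
the radial identity `kf s + 2 s · kf′ s = 2 √s · Bf′ s`, and a point of positive twist rate (mean value
theorem). Folklore calculus; nothing about Navier–Stokes is asserted.
-/

noncomputable section

open MeasureTheory Set Function Filter Topology Metric
open scoped ContDiff Real

namespace Summit.NavierStokesRegularity.FunctionalMining

namespace SpiralJet

/-! ## A gluing lemma: smooth on `(0, ∞)` and constant near `(−∞, a)` -/

/-- A function that is `C^n` on `(0, ∞)` and constant on `(−∞, a)` for some `a > 0` is `C^n` on `ℝ`.
[folklore] -/
theorem contDiff_of_contDiffOn_Ioi_of_eq_const {f : ℝ → ℝ} {n : WithTop ℕ∞} {a c : ℝ} (ha : 0 < a)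
    (hf : ContDiffOn ℝ n f (Ioi 0)) (hc : ∀ s, s < a → f s = c) : ContDiff ℝ n f := by
  rw [contDiff_iff_contDiffAt]
  intro s
  rcases lt_or_ge s a with hs | hs
  · have hev : f =ᶠ[𝓝 s] fun _ => c := by
      filter_upwards [Iio_mem_nhds hs] with t ht using hc t ht
    exact (contDiffAt_const.congr_of_eventuallyEq hev)
  · exact hf.contDiffAt (Ioi_mem_nhds (lt_of_lt_of_le ha hs))

/-! ## The radial plateau bump `Bf` -/

/-- The plateau bump in the variable `s = x² + y²`: centred at `1/16`, `= 1` on `[1/32, 3/32]`,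
supported in `(1/128, 15/128)`. [ours, bookkeeping] -/
def sBump : ContDiffBump (1 / 16 : ℝ) := ⟨1 / 32, 7 / 128, by norm_num, by norm_num⟩

/-- `Bf s = sBump s`. [ours, bookkeeping] -/
def Bf (s : ℝ) : ℝ := sBump s

/-- `Bf` is smooth. [folklore] -/
theorem contDiff_Bf : ContDiff ℝ ∞ Bf := sBump.contDiff

/-- `Bf` is differentiable. [folklore] -/
theorem differentiable_Bf : Differentiable ℝ Bf := contDiff_Bf.differentiable (by simp)

/-- `0 ≤ Bf`. [folklore] -/
theorem Bf_nonneg (s : ℝ) : 0 ≤ Bf s := sBump.nonneg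

/-- `Bf ≤ 1`. [folklore] -/
theorem Bf_le_one (s : ℝ) : Bf s ≤ 1 := sBump.le_one

/-- `Bf = 1` on the plateau `|s − 1/16| ≤ 1/32`. [folklore] -/
theorem Bf_eq_one {s : ℝ} (h : |s - 1 / 16| ≤ 1 / 32) : Bf s = 1 :=
  sBump.one_of_mem_closedBall (by simpa [sBump, Real.dist_eq] using h)

/-- `Bf = 0` off the open support `|s − 1/16| < 7/128`. [folklore] -/
theorem Bf_eq_zero {s : ℝ} (h : 7 / 128 ≤ |s - 1 / 16|) : Bf s = 0 :=
  sBump.zero_of_le_dist (by simpa [sBump, Real.dist_eq] using h)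

/-- `Bf′ = 0` on the plateau (local maximum of `Bf ≤ 1`). [folklore] -/
theorem dBf_eq_zero_of_plateau {s : ℝ} (h : |s - 1 / 16| ≤ 1 / 32) : deriv Bf s = 0 := by
  have hmax : IsLocalMax Bf s := Filter.Eventually.of_forall fun t => by
    rw [Bf_eq_one h]; exact Bf_le_one t
  exact hmax.deriv_eq_zero

/-- `Bf′ = 0` off the open support (local minimum of `Bf ≥ 0`). [folklore] -/
theorem dBf_eq_zero_of_out {s : ℝ} (h : 7 / 128 ≤ |s - 1 / 16|) : deriv Bf s = 0 := by
  have hmin : IsLocalMin Bf s := Filter.Eventually.of_forall fun t => by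
    rw [Bf_eq_zero h]; exact Bf_nonneg t
  exact hmin.deriv_eq_zero

/-- The collar dichotomy for `Bf`: if `Bf′(s) ≠ 0` then `s < 1/32` or `3/32 < s`, and `1/128 < s`.
[ours, bookkeeping] -/
theorem collar_of_dBf_ne_zero {s : ℝ} (h : deriv Bf s ≠ 0) :
    (s < 1 / 32 ∨ 3 / 32 < s) ∧ 1 / 128 < s := by
  have h1 : ¬ |s - 1 / 16| ≤ 1 / 32 := fun h' => h (dBf_eq_zero_of_plateau h')
  have h2 : ¬ 7 / 128 ≤ |s - 1 / 16| := fun h' => h (dBf_eq_zero_of_out h')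
  rw [not_le] at h1 h2
  rw [abs_lt] at h2
  refine ⟨?_, by linarith [h2.1]⟩
  by_contra hcon
  rw [not_or, not_lt, not_lt] at hcon
  exact (lt_irrefl _) (h1.trans_le (abs_le.2 ⟨by linarith [hcon.1], by linarith [hcon.2]⟩))

/-! ## The amplitude `kf = Bf / √s` -/

/-- `kf s = Bf s · (√s)⁻¹` (so that `ρ ↦ ρ·kf(ρ²) = Bf(ρ²)` is FLAT in `ρ` on the plateau). [ours] -/
def kf (s : ℝ) : ℝ := Bf s * (Real.sqrt s)⁻¹

/-- `kf = 0` for `s < 1/128` (indeed wherever `Bf = 0`). [ours, bookkeeping] -/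
theorem kf_eq_zero_of_lt {s : ℝ} (h : s < 1 / 128) : kf s = 0 := by
  have : Bf s = 0 := Bf_eq_zero (by rw [abs_of_nonpos (by linarith)]; linarith)
  simp [kf, this]

/-- `kf = 0` wherever `Bf` vanishes by support, `|s − 1/16| ≥ 7/128`. [ours, bookkeeping] -/
theorem kf_eq_zero_of_out {s : ℝ} (h : 7 / 128 ≤ |s - 1 / 16|) : kf s = 0 := by
  simp [kf, Bf_eq_zero h]

/-- `kf` is smooth on `ℝ`. [folklore] -/
theorem contDiff_kf : ContDiff ℝ ∞ kf := by
  refine contDiff_of_contDiffOn_Ioi_of_eq_const (a := 1 / 128) (c := 0) (by norm_num) ?_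
    fun s hs => kf_eq_zero_of_lt hs
  intro s hs
  have hs' : (0 : ℝ) < s := hs
  have h1 : ContDiffAt ℝ ∞ (fun s => (Real.sqrt s)⁻¹) s :=
    (Real.contDiffAt_sqrt hs'.ne').inv (Real.sqrt_pos.2 hs').ne'
  exact (contDiff_Bf.contDiffAt.mul h1).contDiffWithinAt

/-- `kf` is differentiable. [folklore] -/
theorem differentiable_kf : Differentiable ℝ kf := contDiff_kf.differentiable (by simp)

/-- `0 ≤ kf`. [folklore] -/
theorem kf_nonneg (s : ℝ) : 0 ≤ kf s := mul_nonneg (Bf_nonneg s) (inv_nonneg.2 (Real.sqrt_nonneg s))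

/-- `kf′ = 0` for `s < 1/128` (`kf` vanishes identically there). [folklore] -/
theorem dkf_eq_zero_of_lt {s : ℝ} (h : s < 1 / 128) : deriv kf s = 0 := by
  have hev : kf =ᶠ[𝓝 s] fun _ => (0 : ℝ) := by
    filter_upwards [Iio_mem_nhds h] with t ht using kf_eq_zero_of_lt ht
  rw [hev.deriv_eq, deriv_const]

/-- `kf′ = 0` off the open support (local minimum of `kf ≥ 0`). [folklore] -/
theorem dkf_eq_zero_of_out {s : ℝ} (h : 7 / 128 ≤ |s - 1 / 16|) : deriv kf s = 0 := by
  have hmin : IsLocalMin kf s := Filter.Eventually.of_forall fun t => by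
    rw [kf_eq_zero_of_out h]; exact kf_nonneg t
  exact hmin.deriv_eq_zero

/-- **The radial identity `kf s + 2 s · kf′ s = 2 √s · Bf′ s`** (`(ρ kf(ρ²))′ = Bf′`-bookkeeping:
the combination `k + 2sk′` that multiplies the collar part of the stretching vanishes exactly where
`Bf′` does). [ours, bookkeeping] -/
theorem kf_add_two_mul_deriv (s : ℝ) :
    kf s + 2 * s * deriv kf s = 2 * Real.sqrt s * deriv Bf s := by
  rcases lt_or_ge s (1 / 128) with hs | hs
  · have hB : deriv Bf s = 0 :=
      dBf_eq_zero_of_out (by rw [abs_of_nonpos (by linarith)]; linarith)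
    rw [kf_eq_zero_of_lt hs, dkf_eq_zero_of_lt hs, hB]; ring
  · have hs0 : 0 < s := by linarith
    have hsq : 0 < Real.sqrt s := Real.sqrt_pos.2 hs0
    have h1 : HasDerivAt (fun s => (Real.sqrt s)⁻¹) (-(1 / (2 * Real.sqrt s)) / (Real.sqrt s) ^ 2) s :=
      (Real.hasDerivAt_sqrt hs0.ne').inv hsq.ne'
    have h2 : HasDerivAt kf (deriv Bf s * (Real.sqrt s)⁻¹ +
        Bf s * (-(1 / (2 * Real.sqrt s)) / (Real.sqrt s) ^ 2)) s :=
      (differentiable_Bf s).hasDerivAt.mul h1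
    rw [h2.deriv]
    unfold kf
    have hss : Real.sqrt s ^ 2 = s := Real.sq_sqrt hs0.le
    have hr0 : Real.sqrt s ≠ 0 := hsq.ne'
    rw [show (2 : ℝ) * s = 2 * Real.sqrt s ^ 2 by rw [hss]]
    field_simp
    ring

/-! ## The twist `ψf` and its trigonometric companions -/

/-- The twist angle `ψf s = π · smoothTransition (16 s − 1/2)`: `0` for `s ≤ 1/32`, `π` for
`s ≥ 3/32`, non-decreasing. [ours] -/
def ψf (s : ℝ) : ℝ := π * Real.smoothTransition (16 * s - 1 / 2)

/-- `ψf` is smooth. [folklore] -/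
theorem contDiff_ψf : ContDiff ℝ ∞ ψf :=
  contDiff_const.mul (Real.smoothTransition.contDiff.comp
    ((contDiff_const.mul contDiff_id).sub contDiff_const))

/-- `ψf` is differentiable. [folklore] -/
theorem differentiable_ψf : Differentiable ℝ ψf := contDiff_ψf.differentiable (by simp)

/-- `ψf = 0` for `s ≤ 1/32`. [folklore] -/
theorem ψf_eq_zero {s : ℝ} (h : s ≤ 1 / 32) : ψf s = 0 := by
  unfold ψf
  rw [Real.smoothTransition.zero_of_nonpos (by linarith), mul_zero]

/-- `ψf = π` for `3/32 ≤ s`. [folklore] -/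
theorem ψf_eq_pi {s : ℝ} (h : 3 / 32 ≤ s) : ψf s = π := by
  unfold ψf
  rw [Real.smoothTransition.one_of_one_le (by linarith), mul_one]

/-- `ψf` is monotone. [folklore] -/
theorem monotone_ψf : Monotone ψf := fun a b hab =>
  mul_le_mul_of_nonneg_left (Real.smoothTransition.monotone (by linarith)) Real.pi_pos.le

/-- `0 ≤ ψf′`. [folklore] -/
theorem deriv_ψf_nonneg (s : ℝ) : 0 ≤ deriv ψf s :=
  (differentiable_ψf s).hasDerivAt.nonneg_of_monotone monotone_ψf

/-- `ψf′ = 0` for `s ≤ 1/32` (local minimum of `ψf ≥ 0`). [folklore] -/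
theorem deriv_ψf_eq_zero_of_le {s : ℝ} (h : s ≤ 1 / 32) : deriv ψf s = 0 := by
  have hmin : IsLocalMin ψf s := Filter.Eventually.of_forall fun t => by
    rw [ψf_eq_zero h]
    exact mul_nonneg Real.pi_pos.le (Real.smoothTransition.nonneg _)
  exact hmin.deriv_eq_zero

/-- `ψf′ = 0` for `3/32 ≤ s` (local maximum of `ψf ≤ π`). [folklore] -/
theorem deriv_ψf_eq_zero_of_ge {s : ℝ} (h : 3 / 32 ≤ s) : deriv ψf s = 0 := by
  have hmax : IsLocalMax ψf s := Filter.Eventually.of_forall fun t => by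
    rw [ψf_eq_pi h]
    have := Real.smoothTransition.le_one (16 * t - 1 / 2)
    unfold ψf; nlinarith [Real.pi_pos]
  exact hmax.deriv_eq_zero

/-- `cf = cos ∘ ψf`. [ours, bookkeeping] -/
def cf (s : ℝ) : ℝ := Real.cos (ψf s)

/-- `df = sin ∘ ψf`. [ours, bookkeeping] -/
def df (s : ℝ) : ℝ := Real.sin (ψf s)

/-- `cf` is smooth. [folklore] -/
theorem contDiff_cf : ContDiff ℝ ∞ cf := Real.contDiff_cos.comp contDiff_ψf

/-- `df` is smooth. [folklore] -/
theorem contDiff_df : ContDiff ℝ ∞ df := Real.contDiff_sin.comp contDiff_ψf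

/-- `cf′ = −df · ψf′`. [folklore] -/
theorem hasDerivAt_cf (s : ℝ) : HasDerivAt cf (-(df s * deriv ψf s)) s := by
  have h := (Real.hasDerivAt_cos (ψf s)).comp s (differentiable_ψf s).hasDerivAt
  refine h.congr_deriv ?_
  simp [df]

/-- `df′ = cf · ψf′`. [folklore] -/
theorem hasDerivAt_df (s : ℝ) : HasDerivAt df (cf s * deriv ψf s) s := by
  have h := (Real.hasDerivAt_sin (ψf s)).comp s (differentiable_ψf s).hasDerivAt
  refine h.congr_deriv ?_
  simp [cf]

/-- `cf² + df² = 1`. [folklore] -/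
theorem cf_sq_add_df_sq (s : ℝ) : cf s ^ 2 + df s ^ 2 = 1 := by
  rw [cf, df]; exact Real.cos_sq_add_sin_sq (ψf s)

/-- **Collar/plateau dichotomy.** At every `s`, either `Bf′(s) = 0` (plateau or off support), or we are
on a collar, where the twist is locked: `df s = 0`, `ψf′ s = 0`, `cf s ^ 2 = 1`. [ours, bookkeeping] -/
theorem dichotomy (s : ℝ) :
    deriv Bf s = 0 ∨ (df s = 0 ∧ deriv ψf s = 0 ∧ cf s ^ 2 = 1) := by
  by_cases h : deriv Bf s = 0
  · exact Or.inl h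
  · right
    obtain ⟨hs | hs, -⟩ := collar_of_dBf_ne_zero h
    · refine ⟨by simp [df, ψf_eq_zero hs.le], deriv_ψf_eq_zero_of_le hs.le, ?_⟩
      simp [cf, ψf_eq_zero hs.le]
    · refine ⟨by simp [df, ψf_eq_pi hs.le], deriv_ψf_eq_zero_of_ge hs.le, ?_⟩
      simp [cf, ψf_eq_pi hs.le]

/-- Where the twist turns (`ψf′(s) ≠ 0`) we are strictly inside the plateau: `Bf s = 1`,
`Bf′ s = 0`, and `1/32 < s < 3/32`. [ours, bookkeeping] -/
theorem plateau_of_deriv_ψf_ne_zero {s : ℝ} (h : deriv ψf s ≠ 0) :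
    Bf s = 1 ∧ deriv Bf s = 0 ∧ 1 / 32 < s ∧ s < 3 / 32 := by
  have h1 : 1 / 32 < s := by
    by_contra h'; exact h (deriv_ψf_eq_zero_of_le (not_lt.1 h'))
  have h2 : s < 3 / 32 := by
    by_contra h'; exact h (deriv_ψf_eq_zero_of_ge (not_lt.1 h'))
  have habs : |s - 1 / 16| ≤ 1 / 32 := abs_le.2 ⟨by linarith, by linarith⟩
  exact ⟨Bf_eq_one habs, dBf_eq_zero_of_plateau habs, h1, h2⟩

/-- **A point of positive twist rate** (mean value theorem): `∃ s⋆ ∈ (1/32, 3/32)`, `ψf′(s⋆) = 16π`.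
[folklore] -/
theorem exists_deriv_ψf_pos : ∃ s : ℝ, 1 / 32 < s ∧ s < 3 / 32 ∧ deriv ψf s = 16 * π := by
  obtain ⟨c, hc, hcd⟩ := exists_deriv_eq_slope ψf (show (1 / 32 : ℝ) < 3 / 32 by norm_num)
    differentiable_ψf.continuous.continuousOn (differentiable_ψf.differentiableOn)
  refine ⟨c, hc.1, hc.2, ?_⟩
  rw [hcd, ψf_eq_pi le_rfl, ψf_eq_zero le_rfl]
  ring

end SpiralJet

end Summit.NavierStokesRegularity.FunctionalMining

end
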